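import Summits.HodgeConjecture.CorCM.Hyp413.A3Liu413FaceTypes
import Summits.HodgeConjecture.HodgeConjecture.Theorems.H413MirrorAtPinLine
import Literature.AlgebraicGeometry.Liu2021.AdmissibleElement
import Literature.NumberTheory.Automorphic.IdeleClassCharacterConjugate
import Literature.NumberTheory.GelbartRogawski1991.OscillatorTripleDictionary
import Summits.HodgeConjecture.HodgeConjecture.Theorems.H413ThetaPinBridge
import HarnessLib

/-!
# FLOOR-0 P4, stub S5 (`stub_T3b_conjugatePartnerAt`) — THE CONJUGATE PARTNER AT THE PIN, MODULO REPRESENTATIVE INDEPENDENCE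

Cell hodgecm-mathlib, crux item H413 = stmt-HodgeConjecture-24833, P4 line `Cruxes/H413/Lines/F0_P4AdmissibleOccursInH1.lean`, stub S5
`StubT3bConjugatePartnerAt` (its body restated VERBATIM as the conclusion below; the line file is not importable on the farm).
Sequel of ★ `Theorems/H413WeilFinRepMirror` (J-a), ★ `Theorems/H413MirrorSplittingAtScalar` (J-b), ★ `Theorems/H413MirrorAtPinLine` (J-c:
`exists_conjPartner_omegaAtLine_neg` — for the pin's carriers `ω(μ, ⟨a⟩, χ)` a bijective conjugate-linear `U(V)(𝔸_f)`-equivariant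
`ω(μ, ⟨a⟩, χ) → ω(μ', ⟨−a⟩, χ̄)`, `μ'` of weight one with `Φ_{μ'} = Φ̄_μ`).

**`stubT3bConjugatePartnerAt_of_reprIndependence`** — KERNEL GLUE: S5 follows from ONE displayed hypothesis, the REPRESENTATIVE INDEPENDENCE of
[Liu2021, Def. 4.11]'s carriers at the pin (census F0P4-p03 2026-08-31: the partner triple `t' = (μ', ε(−e), χ̄)` of the datum lives on the line
`⟨r ε(−e)⟩` of the pin's section `r`, a representative of the SAME finite local norm classes as `−a` — `locF (r ε(−e)) = locF (−a)` — but
`≠ −a` in general; [Liu2021, App. D §D.1 Step 1, footnote l. 5215] «another representative gives an isomorphic oscillator representation»):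
`hRI : ∀ μ b b' (locF b = locF b') ψ, ∃ Ψ : ω(μ, ⟨b⟩, ψ) ≃ₗ[ℂ] ω(μ, ⟨b'⟩, ψ), U(V)(𝔸_f)-equivariant`.  Given `hRI`, for every weight-one admissible
`t = (μ, ε, χ)`: `e` admissible with `ε = ε(e)`, `a := r ε`, `(μ', J)` from J-c, `t' := (μ', ε(−e), conj ∘ χ)` — weight one; `μ'`-admissible by `−e`
(★ `isAdmissibleElement_conj_neg_iff`, `Φ_{μ'} = Φ̄_μ` by ★ `IsConjugateSymplectic.cmType_eq`); `ι₁ ∈ Φ_{μ'} ↔ ι₁ ∉ Φ_μ` (`mem_bar_iff`); and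
`J_{t'} := Ψ ∘ J` with `Ψ := hRI μ' (−a) (r ε(−e)) _ χ̄` (`locF (−a) = locF (−1)·locF a = ε(−e) = locF (r ε(−e))`).
So S5 is CLOSED MODULO the one Literature-level statement `hRI`; nothing else.  THEOREMS ONLY (no definition, no named fact — `hRI` is a
displayed hypothesis about the tree's own objects, not a cited fact — no instance, no `sorry`).  HC_CM is proved only modulo the printed citations
until rung 0 closes; this file proves nothing about them.

References: [Liu2021] Y. Liu, Camb. J. Math. 9 (2021), Def. 4.11–4.12 (l. 2083–2111), Rem. 4.4, App. D §D.1 Step 1 footnote (l. 5215), Lem. D.1 (2)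
(l. 5231); [GelbartRogawski1991] Invent. Math. 105 (1991), §3.1 Prop. 3.1.1 p. 455, Remark p. 457; [Li1992] J. reine angew. Math. 428 (1992), p. 181.
-/

set_option autoImplicit false
set_option linter.dupNamespace false

noncomputable section

namespace Summit.HodgeConjecture.HodgeConjecture.Cruxes.H413.ConjugatePartner

open scoped TensorProduct Matrix ComplexConjugate
open NumberField NumberField.InfinitePlace NumberField.ComplexEmbedding IsDedekindDomain
open HodgeCM.Model HodgeCM.Model.LiuIndex HodgeCM.Model.TowerCarrier
open Summit.HodgeConjecture.CorCM.Model
open Literature.AlgebraicGeometry.Motives (CMType AbelianVariety)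
open Literature.AlgebraicGeometry.Liu2021 (IsAdmissibleElement isAdmissibleElement_conj_neg_iff)
open Literature.AlgebraicGeometry.HodgeTheory Literature.NumberTheory.Automorphic.PicardCM
open Literature.AlgebraicGeometry.ShimuraVarieties Literature.AlgebraicGeometry.ShimuraVarieties.UnitaryCanonicalModel
open Literature.NumberTheory.ComplexMultiplication Literature.NumberTheory.ComplexMultiplication.CMTypeOps
open Literature.NumberTheory.Automorphic Literature.NumberTheory.Automorphic.UnitaryGroup
open Literature.NumberTheory.Automorphic.IdeleClassGroup
open Literature.NumberTheory.Automorphic.Liu2021 Literature.NumberTheory.Automorphic.Liu2021.AppendixC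
open Literature.NumberTheory.Automorphic.Liu2021.Def411WeilCarriers
open Literature.NumberTheory.Automorphic.Liu2021.Def411WeilCarriersDoubling (isSplittingChar_toHeckeCharacter_of_isConjugateSymplectic)
open Summit.HodgeConjecture.CorCM.Transposition.OmegaTransport (realUnit)
open Summit.HodgeConjecture.CorCM.Transposition.OmegaChiSplitting (sChiD hsChiD)
open HodgeCM.Model.ArchSideTerm (e₁)
open Literature.NumberTheory.GelbartRogawski1991 Literature.NumberTheory.GelbartRogawski1991.UnitaryDualPair
open Literature.RepresentationTheory Literature.RepresentationTheory.Liu2021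
open Summit.HodgeConjecture.CorCM
open Summit.HodgeConjecture.CorCM.Transposition
open MulAction
open Literature.NumberTheory.GelbartRogawski1991.OscillatorTripleDictionary (rhoTriple)
open Summit.HodgeConjecture.CorCM.Lines.A3Liu413 (datum413)
open Summit.HodgeConjecture.HodgeConjecture.Cruxes.H413.MirrorAtPinLine

/-! ## §1 The element `e ∈ E^{×−}`: `e = x · δ'` with `x ∈ (E⁺)ˣ`, so `ε(e) = locF x`, `ε(−e) = locF (−x)` -/

section Element

variable (L : Type) [Field L] [NumberField L] [IsCMField L]

/-- for a normaliser `δ' ∈ E^{×−}` and `e ∈ E^{×−}` (`ē = −e`, `e ≠ 0`): `e = x · δ'` for a unit `x` of `E⁺`, and then `−e = (−x) · δ'`.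
[cite: Liu2021, Definition 4.12 (l. 2102–2108)] -/
theorem exists_unit_eq_algebraMap_mul (δ' : L) (hδ'c : IsCMField.complexConj L δ' = -δ') (hδ'0 : δ' ≠ 0) (e : L)
    (hec : IsCMField.complexConj L e = -e) (he0 : e ≠ 0) :
    ∃ x : (↥(maximalRealSubfield L))ˣ, e = algebraMap ↥(maximalRealSubfield L) L (x : ↥(maximalRealSubfield L)) * δ' ∧
      -e = algebraMap ↥(maximalRealSubfield L) L (-(x : ↥(maximalRealSubfield L))) * δ' := by
  have hreal : IsCMField.complexConj L (e * δ'⁻¹) = e * δ'⁻¹ := by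
    rw [map_mul, map_inv₀, hec, hδ'c, neg_mul, inv_neg, mul_neg, neg_neg]
  have hmem : e * δ'⁻¹ ∈ maximalRealSubfield L := (IsCMField.complexConj_eq_self_iff (K := L) _).1 hreal
  have hne : (⟨e * δ'⁻¹, hmem⟩ : ↥(maximalRealSubfield L)) ≠ 0 := fun h0 =>
    (mul_ne_zero he0 (inv_ne_zero hδ'0)) (congrArg Subtype.val h0)
  refine ⟨Units.mk0 _ hne, ?_, ?_⟩
  · show e = e * δ'⁻¹ * δ'
    rw [inv_mul_cancel_right₀ hδ'0]
  · rw [map_neg, neg_mul]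
    show -e = -(e * δ'⁻¹ * δ')
    rw [inv_mul_cancel_right₀ hδ'0]

omit [NumberField L] [IsCMField L] in
/-- the conjugate CM type as the set `{τ | τ̄ ∈ Φ}` (for ★ `isAdmissibleElement_conj_neg_iff`). [cite: Liu2021, Remark 4.4] -/
theorem bar_val_eq_setOf (Φ : CMType L) : (bar Φ).1 = {τ : L →+* ℂ | conjugate τ ∈ Φ.1} :=
  Set.ext fun τ => mem_bar_iff_conjugate_mem Φ τ

end Element

/-! ## §2 S5 modulo representative independence -/

set_option synthInstance.maxHeartbeats 400000 in
set_option maxHeartbeats 16000000 in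
-- (the goal carries `datum413`, whose `omega ∕ rho ∕ epsOf ∕ Chi` unfold definitionally to `omegaAtLine ∕ rhoAtLine ∕ Def411WeilCarriers.epsOf ∕ Chi`)
/-- **S5 `StubT3bConjugatePartnerAt` FROM REPRESENTATIVE INDEPENDENCE.**  Hypothesis `hRI` (displayed, [Liu2021, App. D §D.1 Step 1 footnote]): for
every face `(F, V)`, every conjugate-symplectic `μ`, every two units `b, b'` of `F⁺` in the same finite local norm classes (`locF b = locF b'`) and
every `ψ ∈ Chi`, the pin's carriers `ω(μ, ⟨b⟩, ψ)` and `ω(μ, ⟨b'⟩, ψ)` are isomorphic `U(V)(𝔸_f)`-equivariantly.  Conclusion: the body of the line's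
`StubT3bConjugatePartnerAt` VERBATIM — every weight-one admissible triple `t` of the pin's datum has a weight-one admissible partner `t'` with the
`ι₁`-class flipped and a bijective conjugate-linear `rhoTriple`-equivariant `J : ω_V(t) → ω_V(t')` (★ J-c `exists_conjPartner_omegaAtLine_neg` at
`a = r ε`, composed with `hRI μ' (−a) (r ε(−e))`; `t' = (μ', ε(−e), conj ∘ χ)`). [cite: Liu2021, Def. 4.11–4.12; App. D Lem. D.1 (2) (l. 5231), §D.1 Step 1 footnote (l. 5215)]
[cite: GelbartRogawski1991, §3 Prop. 3.1.1 p. 455] -/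
theorem stubT3bConjugatePartnerAt_of_reprIndependence
    (hRI : ∀ (F : HodgeCM.CMField) {ι₁ : F →+* ℂ} (V : HodgeCM.HermSpace3 F ι₁)
      (μ : Literature.NumberTheory.Automorphic.IdeleClassGroup (HodgeCM.CMField.K F) →ₜ* Circle)
      (hμ : IsConjugateSymplectic (HodgeCM.CMField.K F) μ)
      (b b' : (↥(maximalRealSubfield (HodgeCM.CMField.K F)))ˣ)
      (_hbb' : locF ↥(maximalRealSubfield (HodgeCM.CMField.K F)) (imagUnitSq (HodgeCM.CMField.K F)) b =
        locF ↥(maximalRealSubfield (HodgeCM.CMField.K F)) (imagUnitSq (HodgeCM.CMField.K F)) b')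
      (ψ : Chi ↥(maximalRealSubfield (HodgeCM.CMField.K F)) (HodgeCM.CMField.K F) (IsCMField.complexConj (HodgeCM.CMField.K F))),
      ∃ Ψ : omegaAtLine ↥(maximalRealSubfield (HodgeCM.CMField.K F)) (HodgeCM.CMField.K F) (IsCMField.complexConj (HodgeCM.CMField.K F)) 3 e₁
            (Matrix.diagonal (frameD V)) (complexConj_imagUnit (HodgeCM.CMField.K F)) (imagUnit_ne_zero (HodgeCM.CMField.K F))
            (imagUnit_mul_self (HodgeCM.CMField.K F)) (realDiagonal_isSymm (HodgeCM.CMField.K F) (frameD V) (frameD_real V))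
            (isUnit_det_realDiagonal (HodgeCM.CMField.K F) (frameD V) (frameD_real V) (frameD_ne V))
            (realDiagonal_map (HodgeCM.CMField.K F) (frameD V) (frameD_real V)).symm
            (hsChiD (⟨HodgeCM.CMField.K F⟩ : Summit.HodgeConjecture.CorCM.CMField) e₁ (frameD V) (frameD_real V) (frameD_ne V)
              (toHeckeCharacter (HodgeCM.CMField.K F) μ) (isUnitary_toHeckeCharacter (HodgeCM.CMField.K F) μ)
              (isSplittingChar_toHeckeCharacter_of_isConjugateSymplectic (HodgeCM.CMField.K F) μ hμ)) b ψ ≃ₗ[ℂ]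
          omegaAtLine ↥(maximalRealSubfield (HodgeCM.CMField.K F)) (HodgeCM.CMField.K F) (IsCMField.complexConj (HodgeCM.CMField.K F)) 3 e₁
            (Matrix.diagonal (frameD V)) (complexConj_imagUnit (HodgeCM.CMField.K F)) (imagUnit_ne_zero (HodgeCM.CMField.K F))
            (imagUnit_mul_self (HodgeCM.CMField.K F)) (realDiagonal_isSymm (HodgeCM.CMField.K F) (frameD V) (frameD_real V))
            (isUnit_det_realDiagonal (HodgeCM.CMField.K F) (frameD V) (frameD_real V) (frameD_ne V))
            (realDiagonal_map (HodgeCM.CMField.K F) (frameD V) (frameD_real V)).symm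
            (hsChiD (⟨HodgeCM.CMField.K F⟩ : Summit.HodgeConjecture.CorCM.CMField) e₁ (frameD V) (frameD_real V) (frameD_ne V)
              (toHeckeCharacter (HodgeCM.CMField.K F) μ) (isUnitary_toHeckeCharacter (HodgeCM.CMField.K F) μ)
              (isSplittingChar_toHeckeCharacter_of_isConjugateSymplectic (HodgeCM.CMField.K F) μ hμ)) b' ψ,
        ∀ (k : finAdelic ↥(maximalRealSubfield (HodgeCM.CMField.K F)) (HodgeCM.CMField.K F) (IsCMField.complexConj (HodgeCM.CMField.K F)) 3
            (Matrix.diagonal (frameD V))) x,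
          Ψ (rhoVAtLine ↥(maximalRealSubfield (HodgeCM.CMField.K F)) (HodgeCM.CMField.K F) (IsCMField.complexConj (HodgeCM.CMField.K F)) 3 e₁
              (Matrix.diagonal (frameD V)) (complexConj_imagUnit (HodgeCM.CMField.K F)) (imagUnit_ne_zero (HodgeCM.CMField.K F))
              (imagUnit_mul_self (HodgeCM.CMField.K F)) (realDiagonal_isSymm (HodgeCM.CMField.K F) (frameD V) (frameD_real V))
              (isUnit_det_realDiagonal (HodgeCM.CMField.K F) (frameD V) (frameD_real V) (frameD_ne V))
              (realDiagonal_map (HodgeCM.CMField.K F) (frameD V) (frameD_real V)).symm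
              (hsChiD (⟨HodgeCM.CMField.K F⟩ : Summit.HodgeConjecture.CorCM.CMField) e₁ (frameD V) (frameD_real V) (frameD_ne V)
                (toHeckeCharacter (HodgeCM.CMField.K F) μ) (isUnitary_toHeckeCharacter (HodgeCM.CMField.K F) μ)
                (isSplittingChar_toHeckeCharacter_of_isConjugateSymplectic (HodgeCM.CMField.K F) μ hμ)) b ψ k x) =
            rhoVAtLine ↥(maximalRealSubfield (HodgeCM.CMField.K F)) (HodgeCM.CMField.K F) (IsCMField.complexConj (HodgeCM.CMField.K F)) 3 e₁
              (Matrix.diagonal (frameD V)) (complexConj_imagUnit (HodgeCM.CMField.K F)) (imagUnit_ne_zero (HodgeCM.CMField.K F))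
              (imagUnit_mul_self (HodgeCM.CMField.K F)) (realDiagonal_isSymm (HodgeCM.CMField.K F) (frameD V) (frameD_real V))
              (isUnit_det_realDiagonal (HodgeCM.CMField.K F) (frameD V) (frameD_real V) (frameD_ne V))
              (realDiagonal_map (HodgeCM.CMField.K F) (frameD V) (frameD_real V)).symm
              (hsChiD (⟨HodgeCM.CMField.K F⟩ : Summit.HodgeConjecture.CorCM.CMField) e₁ (frameD V) (frameD_real V) (frameD_ne V)
                (toHeckeCharacter (HodgeCM.CMField.K F) μ) (isUnitary_toHeckeCharacter (HodgeCM.CMField.K F) μ)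
                (isSplittingChar_toHeckeCharacter_of_isConjugateSymplectic (HodgeCM.CMField.K F) μ hμ)) b' ψ k (Ψ x)) :
    ∀ (hDel : Literature.AlgebraicGeometry.ShimuraVarieties.UnitaryCanonicalModel.canonicalModel_exists_printed)
      (F : HodgeCM.CMField) [IsGalois ℚ F] (h6 : 6 ≤ Module.finrank ℚ F) {ι₁ : F →+* ℂ} (V : HodgeCM.HermSpace3 F ι₁) (a₀ : RealScalar F)
      (Φ : CMType F) (hΦ : ι₁ ∈ Φ.1) (i : (I V (repAt a₀) (muLiu ι₁ GramClass.rep))),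
      (datum413 hDel F V a₀ Φ i).n = 3 →
        ∀ (t : (datum413 hDel F V a₀ Φ i).Triple), t.HasWeightOne → t.IsAdmissible →
          ∃ t' : (datum413 hDel F V a₀ Φ i).Triple, t'.HasWeightOne ∧ t'.IsAdmissible ∧ (ι₁ ∈ t'.cmType.1 ↔ ι₁ ∉ t.cmType.1) ∧
            ∃ J : (datum413 hDel F V a₀ Φ i).omega t.μ t.isConjugateSymplectic t.ε t.χ →ₛₗ[starRingEnd ℂ]
                (datum413 hDel F V a₀ Φ i).omega t'.μ t'.isConjugateSymplectic t'.ε t'.χ,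
              Function.Bijective J ∧
                ∀ (g : ↥(HodgeCM.HermSpace3.adelicFin V)) (v : (datum413 hDel F V a₀ Φ i).omega t.μ t.isConjugateSymplectic t.ε t.χ),
                  J (rhoTriple (datum413 hDel F V a₀ Φ i) t g v) = rhoTriple (datum413 hDel F V a₀ Φ i) t' g (J v) := by
  intro hDel F _ h6 ι₁ V a₀ Φ hΦ i _hn t hw ha
  -- the pin's section `r` (one for all `μ`) and its line `a := r ε`
  let r : Rep ↥(maximalRealSubfield (HodgeCM.CMField.K F)) (imagUnitSq (HodgeCM.CMField.K F)) :=
    Rep.update ↥(maximalRealSubfield (HodgeCM.CMField.K F)) (imagUnitSq (HodgeCM.CMField.K F))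
      (Rep.ofLineOf ↥(maximalRealSubfield (HodgeCM.CMField.K F)) (imagUnitSq (HodgeCM.CMField.K F)))
      (locF ↥(maximalRealSubfield (HodgeCM.CMField.K F)) (imagUnitSq (HodgeCM.CMField.K F))
        (realUnit ⟨HodgeCM.CMField.K F⟩ (repAt a₀ (Sigma.fst i)).1 (repAt a₀ (Sigma.fst i)).2.1 (repAt a₀ (Sigma.fst i)).2.2))
      (realUnit ⟨HodgeCM.CMField.K F⟩ (repAt a₀ (Sigma.fst i)).1 (repAt a₀ (Sigma.fst i)).2.1 (repAt a₀ (Sigma.fst i)).2.2) rfl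
  -- the admissible element `e` of `t` and its decomposition `e = x · δ'`
  obtain ⟨e, he, hε⟩ := ha
  obtain ⟨x, hex, hnex⟩ := exists_unit_eq_algebraMap_mul (HodgeCM.CMField.K F) (2 * imagUnit (HodgeCM.CMField.K F))⁻¹
    (ThetaPinBridge.complexConj_two_mul_imagUnit_inv (HodgeCM.CMField.K F)) (ThetaPinBridge.two_mul_imagUnit_inv_ne_zero (HodgeCM.CMField.K F)) e he.2.1 he.1
  -- the collections of `e` and `−e`
  have hεe : (datum413 hDel F V a₀ Φ i).epsOf e = locF ↥(maximalRealSubfield (HodgeCM.CMField.K F)) (imagUnitSq (HodgeCM.CMField.K F)) x := by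
    show epsOf ↥(maximalRealSubfield (HodgeCM.CMField.K F)) (imagUnitSq (HodgeCM.CMField.K F)) (HodgeCM.CMField.K F)
        (2 * imagUnit (HodgeCM.CMField.K F))⁻¹ e = _
    rw [hex]
    exact epsOf_algebraMap_mul _ _ _ _ (ThetaPinBridge.two_mul_imagUnit_inv_ne_zero (HodgeCM.CMField.K F)) x
  have hεne : (datum413 hDel F V a₀ Φ i).epsOf (-e) = locF ↥(maximalRealSubfield (HodgeCM.CMField.K F)) (imagUnitSq (HodgeCM.CMField.K F)) (-x) := by
    show epsOf ↥(maximalRealSubfield (HodgeCM.CMField.K F)) (imagUnitSq (HodgeCM.CMField.K F)) (HodgeCM.CMField.K F)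
        (2 * imagUnit (HodgeCM.CMField.K F))⁻¹ (-e) = _
    rw [hnex]
    exact epsOf_algebraMap_mul _ _ _ _ (ThetaPinBridge.two_mul_imagUnit_inv_ne_zero (HodgeCM.CMField.K F)) (-x)
  -- the two lines: `a := r ε` with `locF a = ε = locF x`, `a'' := r ε(−e)` with `locF a'' = locF (−x) = locF (−a)`
  have hla : locF ↥(maximalRealSubfield (HodgeCM.CMField.K F)) (imagUnitSq (HodgeCM.CMField.K F)) (r.toFun t.ε) =
      locF ↥(maximalRealSubfield (HodgeCM.CMField.K F)) (imagUnitSq (HodgeCM.CMField.K F)) x :=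
    (r.locF_toFun t.ε ⟨x, hεe ▸ hε⟩).trans (hε ▸ hεe)
  have hla'' : locF ↥(maximalRealSubfield (HodgeCM.CMField.K F)) (imagUnitSq (HodgeCM.CMField.K F))
        (r.toFun ((datum413 hDel F V a₀ Φ i).epsOf (-e))) =
      locF ↥(maximalRealSubfield (HodgeCM.CMField.K F)) (imagUnitSq (HodgeCM.CMField.K F)) (-x) :=
    (r.locF_toFun _ ⟨-x, hεne.symm⟩).trans hεne
  have hloc : locF ↥(maximalRealSubfield (HodgeCM.CMField.K F)) (imagUnitSq (HodgeCM.CMField.K F)) (-r.toFun t.ε) =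
      locF ↥(maximalRealSubfield (HodgeCM.CMField.K F)) (imagUnitSq (HodgeCM.CMField.K F))
        (r.toFun ((datum413 hDel F V a₀ Φ i).epsOf (-e))) := by
    rw [hla'', ← neg_one_mul (r.toFun t.ε), ← neg_one_mul x, map_mul, map_mul, hla]
  -- the partner character `μ'` and the conjugate-linear map at the mirror line `−a` (J-c)
  obtain ⟨μ', hμ', hw', hΦ', J, hJb, hJeq⟩ := exists_conjPartner_omegaAtLine_neg V t.μ t.isConjugateSymplectic hw
    t.isConjugateSymplectic.hasCMType_cmType
    ((isOscillatorChar_toHeckeCharacter_iff t.μ).mpr t.isConjugateSymplectic) (r.toFun t.ε) t.χ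
  -- the conjugate character `χ̄ ∈ Chi`
  let χbar : Chi ↥(maximalRealSubfield (HodgeCM.CMField.K F)) (HodgeCM.CMField.K F) (IsCMField.complexConj (HodgeCM.CMField.K F)) :=
    ⟨(Units.map ((starRingEnd ℂ : ℂ →+* ℂ) : ℂ →* ℂ)).comp t.χ.1,
      isAutomorphicOneChar_unitsMap_comp_chi (IsCMField.complexConj (HodgeCM.CMField.K F)) t.χ _⟩
  -- representative independence: `ω(μ', ⟨−a⟩, χ̄) ≃ ω(μ', ⟨r ε(−e)⟩, χ̄)`
  obtain ⟨Ψ, hΨ⟩ := hRI F V μ' hμ' (-r.toFun t.ε) (r.toFun ((datum413 hDel F V a₀ Φ i).epsOf (-e))) hloc χbar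
  -- the CM type of `μ'` is the conjugate type
  have hcm' : hμ'.cmType = bar t.cmType := hμ'.cmType_eq hΦ'
  -- the partner triple
  refine ⟨⟨μ', hμ', (datum413 hDel F V a₀ Φ i).epsOf (-e), χbar⟩, hw', ⟨-e, ?_, rfl⟩, ?_, ?_⟩
  · -- `−e` is `μ'`-admissible
    show IsAdmissibleElement (HodgeCM.CMField.K F) hμ'.cmType.1 (-e)
    rw [hcm', bar_val_eq_setOf]
    exact (isAdmissibleElement_conj_neg_iff _ e).2 he
  · -- the `ι₁`-class flips
    show ι₁ ∈ hμ'.cmType.1 ↔ ι₁ ∉ t.cmType.1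
    rw [hcm']
    exact mem_bar_iff _ _
  · -- `J_{t'} := Ψ ∘ J`
    -- convert the goal's carriers `P.omega ∕ rhoTriple` to `omegaAtLine ∕ rhoVAtLine` ONCE (definitional unfolding of `datum413`)
    show ∃ J' : omegaAtLine ↥(maximalRealSubfield (HodgeCM.CMField.K F)) (HodgeCM.CMField.K F) (IsCMField.complexConj (HodgeCM.CMField.K F)) 3 e₁
          (Matrix.diagonal (frameD V)) (complexConj_imagUnit (HodgeCM.CMField.K F)) (imagUnit_ne_zero (HodgeCM.CMField.K F))
          (imagUnit_mul_self (HodgeCM.CMField.K F)) (realDiagonal_isSymm (HodgeCM.CMField.K F) (frameD V) (frameD_real V))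
          (isUnit_det_realDiagonal (HodgeCM.CMField.K F) (frameD V) (frameD_real V) (frameD_ne V))
          (realDiagonal_map (HodgeCM.CMField.K F) (frameD V) (frameD_real V)).symm
          (hsChiD (⟨HodgeCM.CMField.K F⟩ : Summit.HodgeConjecture.CorCM.CMField) e₁ (frameD V) (frameD_real V) (frameD_ne V)
            (toHeckeCharacter (HodgeCM.CMField.K F) t.μ) (isUnitary_toHeckeCharacter (HodgeCM.CMField.K F) t.μ)
            ((isOscillatorChar_toHeckeCharacter_iff t.μ).mpr t.isConjugateSymplectic)) (r.toFun t.ε) t.χ →ₛₗ[starRingEnd ℂ]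
        omegaAtLine ↥(maximalRealSubfield (HodgeCM.CMField.K F)) (HodgeCM.CMField.K F) (IsCMField.complexConj (HodgeCM.CMField.K F)) 3 e₁
          (Matrix.diagonal (frameD V)) (complexConj_imagUnit (HodgeCM.CMField.K F)) (imagUnit_ne_zero (HodgeCM.CMField.K F))
          (imagUnit_mul_self (HodgeCM.CMField.K F)) (realDiagonal_isSymm (HodgeCM.CMField.K F) (frameD V) (frameD_real V))
          (isUnit_det_realDiagonal (HodgeCM.CMField.K F) (frameD V) (frameD_real V) (frameD_ne V))
          (realDiagonal_map (HodgeCM.CMField.K F) (frameD V) (frameD_real V)).symm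
          (hsChiD (⟨HodgeCM.CMField.K F⟩ : Summit.HodgeConjecture.CorCM.CMField) e₁ (frameD V) (frameD_real V) (frameD_ne V)
            (toHeckeCharacter (HodgeCM.CMField.K F) μ') (isUnitary_toHeckeCharacter (HodgeCM.CMField.K F) μ')
            ((isOscillatorChar_toHeckeCharacter_iff μ').mpr hμ')) (r.toFun ((datum413 hDel F V a₀ Φ i).epsOf (-e))) χbar,
      Function.Bijective J' ∧
        ∀ (g : ↥(HodgeCM.HermSpace3.adelicFin V)) (v : omegaAtLine ↥(maximalRealSubfield (HodgeCM.CMField.K F)) (HodgeCM.CMField.K F)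
            (IsCMField.complexConj (HodgeCM.CMField.K F)) 3 e₁
            (Matrix.diagonal (frameD V)) (complexConj_imagUnit (HodgeCM.CMField.K F)) (imagUnit_ne_zero (HodgeCM.CMField.K F))
            (imagUnit_mul_self (HodgeCM.CMField.K F)) (realDiagonal_isSymm (HodgeCM.CMField.K F) (frameD V) (frameD_real V))
            (isUnit_det_realDiagonal (HodgeCM.CMField.K F) (frameD V) (frameD_real V) (frameD_ne V))
            (realDiagonal_map (HodgeCM.CMField.K F) (frameD V) (frameD_real V)).symm
            (hsChiD (⟨HodgeCM.CMField.K F⟩ : Summit.HodgeConjecture.CorCM.CMField) e₁ (frameD V) (frameD_real V) (frameD_ne V)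
              (toHeckeCharacter (HodgeCM.CMField.K F) t.μ) (isUnitary_toHeckeCharacter (HodgeCM.CMField.K F) t.μ)
              ((isOscillatorChar_toHeckeCharacter_iff t.μ).mpr t.isConjugateSymplectic)) (r.toFun t.ε) t.χ),
          J' (rhoVAtLine ↥(maximalRealSubfield (HodgeCM.CMField.K F)) (HodgeCM.CMField.K F) (IsCMField.complexConj (HodgeCM.CMField.K F)) 3 e₁
              (Matrix.diagonal (frameD V)) (complexConj_imagUnit (HodgeCM.CMField.K F)) (imagUnit_ne_zero (HodgeCM.CMField.K F))
              (imagUnit_mul_self (HodgeCM.CMField.K F)) (realDiagonal_isSymm (HodgeCM.CMField.K F) (frameD V) (frameD_real V))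
              (isUnit_det_realDiagonal (HodgeCM.CMField.K F) (frameD V) (frameD_real V) (frameD_ne V))
              (realDiagonal_map (HodgeCM.CMField.K F) (frameD V) (frameD_real V)).symm
              (hsChiD (⟨HodgeCM.CMField.K F⟩ : Summit.HodgeConjecture.CorCM.CMField) e₁ (frameD V) (frameD_real V) (frameD_ne V)
                (toHeckeCharacter (HodgeCM.CMField.K F) t.μ) (isUnitary_toHeckeCharacter (HodgeCM.CMField.K F) t.μ)
                ((isOscillatorChar_toHeckeCharacter_iff t.μ).mpr t.isConjugateSymplectic)) (r.toFun t.ε) t.χ (ιVE V g) v) =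
            rhoVAtLine ↥(maximalRealSubfield (HodgeCM.CMField.K F)) (HodgeCM.CMField.K F) (IsCMField.complexConj (HodgeCM.CMField.K F)) 3 e₁
              (Matrix.diagonal (frameD V)) (complexConj_imagUnit (HodgeCM.CMField.K F)) (imagUnit_ne_zero (HodgeCM.CMField.K F))
              (imagUnit_mul_self (HodgeCM.CMField.K F)) (realDiagonal_isSymm (HodgeCM.CMField.K F) (frameD V) (frameD_real V))
              (isUnit_det_realDiagonal (HodgeCM.CMField.K F) (frameD V) (frameD_real V) (frameD_ne V))
              (realDiagonal_map (HodgeCM.CMField.K F) (frameD V) (frameD_real V)).symm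
              (hsChiD (⟨HodgeCM.CMField.K F⟩ : Summit.HodgeConjecture.CorCM.CMField) e₁ (frameD V) (frameD_real V) (frameD_ne V)
                (toHeckeCharacter (HodgeCM.CMField.K F) μ') (isUnitary_toHeckeCharacter (HodgeCM.CMField.K F) μ')
                ((isOscillatorChar_toHeckeCharacter_iff μ').mpr hμ')) (r.toFun ((datum413 hDel F V a₀ Φ i).epsOf (-e))) χbar (ιVE V g)
              (J' v)
    refine ⟨Ψ.toLinearMap.comp J, ?_, fun g v => ?_⟩
    · rw [LinearMap.coe_comp, LinearEquiv.coe_coe]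
      exact Ψ.bijective.comp hJb
    · rw [LinearMap.comp_apply, LinearMap.comp_apply, LinearEquiv.coe_coe, hJeq, hΨ]

end Summit.HodgeConjecture.HodgeConjecture.Cruxes.H413.ConjugatePartner

end
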